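import Mathlib
import Summits.Ventures.PercRepro2.CutFarOA3Theorem

/-!
# `o` behind `a₃`: every typed base vanishes (blind cell PercRepro2, p3 g3, 2026-08-25;
`proofs/P3-BRIDGE.md` §11.17)

When the mark `a₃` separates `o` from both roots — in every configuration below `z ∪ F`,
`o ↔ a₁` forces `a₃ ↔ a₁` and `o ↔ a₂` forces `a₃ ↔ a₂` — the six-fold copy-symmetrised kernel
is IDENTICALLY ZERO on the 21 valid copy-states of the class (`symK_eq_zero_oBehind`, `decide`;
the unsymmetrised kernel is not zero there, and neither symmetrisation nor the class alone
suffices without validity), so every typed base vanishes (`typedCount_eq_zero_of_oBehindA3`):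
the typed form of night-3's coincidence `o = a₃` (`TypedCoincidence.lean`) for a whole pocket.
The mirror class «`b` behind `a₃`» does NOT vanish (symmetrised entries from `−8` to `4`).
(`ValidQSt` / `symKB` restate `TypedUncrossed.lean`'s `ValidSt` / `symK` — kept local so the file
depends only on `CutFarOA3Theorem`.)  Own work; standard axioms.
-/

namespace Summit.Ventures.PercRepro2

open UnionCluster

namespace CovForm

namespace RootBridge

open OneTyped TypedA3 Untouched TypedFactor Separated

section OBehind

open Classical

/-- A state has `o` behind `a₃`: `o` at a root forces `a₃` at that root. -/
def OBehindSt (s : St) : Bool := (!s.Lo || s.L3) && (!s.Ho || s.H3)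

/-- Validity, first half: when `a₁ ↔ a₂`, each mark sees both roots or neither. -/
def ValidQSt (s : St) : Bool :=
  (!s.q' || (s.Lo == s.Ho)) && (!s.q' || (s.Lb == s.Hb)) && (!s.q' || (s.L3 == s.H3))

/-- Validity, second half: a mark seeing both roots forces `a₁ ↔ a₂`. -/
def NoBothSt (s : St) : Bool :=
  (!(s.Lo && s.Ho) || s.q') && (!(s.Lb && s.Hb) || s.q') && (!(s.L3 && s.H3) || s.q')

/-- The six-fold symmetrisation of the kernel over the three copies. -/
def symKB (x y w : St) : ℤ :=
  KB x y w + KB x w y + KB y x w + KB y w x + KB w x y + KB w y x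

/-- The 21 valid states with `o` behind `a₃`. -/
def oBehindStates : List St :=
  [(false, false, false, false, false, false, false),
    (false, false, false, false, false, false, true),
    (false, false, false, false, false, true, false),
    (false, false, false, false, true, false, false),
    (false, false, false, false, true, false, true),
    (false, false, false, false, true, true, false),
    (false, false, false, true, false, false, false),
    (false, false, false, true, false, false, true),
    (false, false, false, true, false, true, false),
    (false, false, true, false, false, false, true),
    (false, false, true, false, true, false, true),
    (false, false, true, true, false, false, true),
    (false, true, false, false, false, true, false),
    (false, true, false, false, true, true, false),
    (false, true, false, true, false, true, false),
    (true, false, false, false, false, false, false),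
    (true, false, false, false, false, true, true),
    (true, false, false, true, true, false, false),
    (true, false, false, true, true, true, true),
    (true, true, true, false, false, true, true),
    (true, true, true, true, true, true, true)]

/-- Every valid state with `o` behind `a₃` is one of the 21. -/
theorem mem_oBehindStates (a b c d e f g : Bool) (h1 : OBehindSt (a, b, c, d, e, f, g) = true)
    (h2 : ValidQSt (a, b, c, d, e, f, g) = true) (h3 : NoBothSt (a, b, c, d, e, f, g) = true) :
    (a, b, c, d, e, f, g) ∈ oBehindStates := by
  revert a b c d e f g
  decide +kernel

/-- The symmetrised kernel vanishes on every triple of the 21 states (Boolean form). -/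
theorem symK_eq_zero_all :
    (oBehindStates.all fun x => oBehindStates.all fun y => oBehindStates.all fun w =>
      decide (symKB x y w = 0)) = true := by
  decide +kernel

/-- **The symmetrised kernel vanishes on valid triples with `o` behind `a₃`.** -/
theorem symK_eq_zero_oBehind (x y w : St) (hx : OBehindSt x = true) (hx' : ValidQSt x = true)
    (hx'' : NoBothSt x = true) (hy : OBehindSt y = true) (hy' : ValidQSt y = true)
    (hy'' : NoBothSt y = true) (hw : OBehindSt w = true) (hw' : ValidQSt w = true)
    (hw'' : NoBothSt w = true) : symKB x y w = 0 := by
  have h := symK_eq_zero_all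
  simp only [List.all_eq_true, decide_eq_true_eq] at h
  obtain ⟨a1, b1, c1, d1, e1, f1, g1⟩ := x
  obtain ⟨a2, b2, c2, d2, e2, f2, g2⟩ := y
  obtain ⟨a3, b3, c3, d3, e3, f3, g3⟩ := w
  exact h _ (mem_oBehindStates _ _ _ _ _ _ _ hx hx' hx'') _ (mem_oBehindStates _ _ _ _ _ _ _ hy hy' hy'')
    _ (mem_oBehindStates _ _ _ _ _ _ _ hw hw' hw'')

variable {V : Type*} {E : Type*} [Fintype E] [DecidableEq E] {R : Type*} [Field R]
  [LinearOrder R] [IsStrictOrderedRing R]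
variable (ends : E → Sym2 V) (o a₁ a₂ a₃ b : V)

/-- The class: `a₃` separates `o` from both roots in every configuration below `z ∪ F`. -/
structure OBehindA3 (F : Finset E) (z : Config E) : Prop where
  behind : ∀ x : Config E, x ≤ zF F z →
    (Conn ends x a₁ o → Conn ends x a₁ a₃) ∧ (Conn ends x a₂ o → Conn ends x a₂ a₃)

omit [Fintype E] [DecidableEq E] in
/-- The state of a configuration with `o` behind `a₃`. -/
lemma oBehindSt_st {x : Config E}
    (h : (Conn ends x a₁ o → Conn ends x a₁ a₃) ∧ (Conn ends x a₂ o → Conn ends x a₂ a₃)) :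
    OBehindSt (st ends o a₁ a₂ a₃ b x) = true := by
  unfold OBehindSt st St.Lo St.Ho St.L3 St.H3
  simp only [Bool.and_eq_true, Bool.or_eq_true, Bool.not_eq_true', decide_eq_false_iff_not,
    decide_eq_true_eq]
  constructor
  · by_cases h1 : Conn ends x a₁ o
    · exact Or.inr (h.1 h1)
    · exact Or.inl h1
  · by_cases h2 : Conn ends x a₂ o
    · exact Or.inr (h.2 h2)
    · exact Or.inl h2

omit [Fintype E] [DecidableEq E] in
/-- The state of a configuration satisfies the first half of validity: transitivity. -/
lemma validQSt_st (x : Config E) : ValidQSt (st ends o a₁ a₂ a₃ b x) = true := by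
  unfold ValidQSt st St.q' St.Lo St.Ho St.Lb St.Hb St.L3 St.H3
  by_cases hq : Conn ends x a₂ a₁
  · have h1 : Conn ends x a₁ o ↔ Conn ends x a₂ o :=
      ⟨fun h => conn_trans hq h, fun h => conn_trans (conn_symm hq) h⟩
    have h2 : Conn ends x a₁ b ↔ Conn ends x a₂ b :=
      ⟨fun h => conn_trans hq h, fun h => conn_trans (conn_symm hq) h⟩
    have h3 : Conn ends x a₁ a₃ ↔ Conn ends x a₂ a₃ :=
      ⟨fun h => conn_trans hq h, fun h => conn_trans (conn_symm hq) h⟩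
    simp only [hq, decide_true, Bool.not_true, Bool.false_or, Bool.and_eq_true, beq_iff_eq,
      decide_eq_decide]
    exact ⟨⟨h1, h2⟩, h3⟩
  · simp [hq]

omit [Fintype E] [DecidableEq E] in
/-- The state of a configuration satisfies the second half of validity. -/
lemma noBothSt_st (x : Config E) : NoBothSt (st ends o a₁ a₂ a₃ b x) = true := by
  unfold NoBothSt st St.q' St.Lo St.Ho St.Lb St.Hb St.L3 St.H3
  simp only [Bool.and_eq_true]
  refine ⟨⟨?_, ?_⟩, ?_⟩
  · exact imp_clause' _ _ _ fun h1 h2 => conn_trans h2 (conn_symm h1)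
  · exact imp_clause' _ _ _ fun h1 h2 => conn_trans h2 (conn_symm h1)
  · exact imp_clause' _ _ _ fun h1 h2 => conn_trans h2 (conn_symm h1)

omit [LinearOrder R] [IsStrictOrderedRing R] in
/-- A typed count of a kernel vanishing on the support of the count vanishes. -/
lemma typedCount_eq_zero_of_zero_on' (F : Finset E) (z : Config E) (τ : E → ℕ)
    {K : Config E → Config E → Config E → R}
    (hK : ∀ x y w, (∀ e, e ∉ F → x e = z e) → (∀ e, e ∉ F → y e = z e) →
      (∀ e, e ∉ F → w e = z e) → K x y w = 0) :
    typedCount F z τ K = 0 := by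
  unfold typedCount
  refine Finset.sum_eq_zero fun x _ => Finset.sum_eq_zero fun y _ => Finset.sum_eq_zero fun w _ => ?_
  split_ifs with h
  · exact hK x y w (fun e he => (h.1 e he).1) (fun e he => (h.1 e he).2.1)
      (fun e he => (h.1 e he).2.2)
  · rfl

/-- **Every typed base vanishes when `a₃` separates `o` from the roots.** -/
theorem typedCount_eq_zero_of_oBehindA3 (F : Finset E) (z : Config E) (τ : E → ℕ)
    (hτ : ∀ e ∈ F, τ e = 1 ∨ τ e = 2) (h : OBehindA3 ends o a₁ a₂ a₃ F z) :
    typedCount F z τ (K3 ends o a₁ a₂ a₃ b : Config E → Config E → Config E → R) = 0 := by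
  have h6 := six_mul_typedCount F z τ hτ (K3 ends o a₁ a₂ a₃ b : Config E → Config E → Config E → R)
  have hK : typedCount F z τ (fun x y w =>
      ((symKB (st ends o a₁ a₂ a₃ b x) (st ends o a₁ a₂ a₃ b y) (st ends o a₁ a₂ a₃ b w) : ℤ) : R)) = 0 := by
    refine typedCount_eq_zero_of_zero_on' F z τ fun x y w hx hy hw => ?_
    rw [symK_eq_zero_oBehind _ _ _ (oBehindSt_st ends o a₁ a₂ a₃ b (h.behind x (le_zF hx)))
      (validQSt_st ends o a₁ a₂ a₃ b x) (noBothSt_st ends o a₁ a₂ a₃ b x)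
      (oBehindSt_st ends o a₁ a₂ a₃ b (h.behind y (le_zF hy))) (validQSt_st ends o a₁ a₂ a₃ b y)
      (noBothSt_st ends o a₁ a₂ a₃ b y) (oBehindSt_st ends o a₁ a₂ a₃ b (h.behind w (le_zF hw)))
      (validQSt_st ends o a₁ a₂ a₃ b w) (noBothSt_st ends o a₁ a₂ a₃ b w)]
    simp
  have hsym : typedCount F z τ (fun x y w =>
      ((symKB (st ends o a₁ a₂ a₃ b x) (st ends o a₁ a₂ a₃ b y) (st ends o a₁ a₂ a₃ b w) : ℤ) : R)) =
      typedCount F z τ (fun x y w =>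
        (K3 ends o a₁ a₂ a₃ b x y w : R) + K3 ends o a₁ a₂ a₃ b x w y + K3 ends o a₁ a₂ a₃ b y x w +
          K3 ends o a₁ a₂ a₃ b y w x + K3 ends o a₁ a₂ a₃ b w x y + K3 ends o a₁ a₂ a₃ b w y x) := by
    refine typedCount_congr' _ _ _ _ _ fun x y w => ?_
    simp only [K3_eq_KB]
    unfold symKB
    push_cast
    ring
  have h6' : (6 : R) * typedCount F z τ (K3 ends o a₁ a₂ a₃ b : Config E → Config E → Config E → R) = 0 := by
    rw [h6, ← hsym]
    exact hK
  exact (mul_eq_zero.mp h6').resolve_left (by norm_num)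

end OBehind

end RootBridge

end CovForm

end Summit.Ventures.PercRepro2
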